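import Summits.RiemannHypothesis.RiemannHypothesis.Theorems.PfPersistenceBottomVectors
import HarnessLib

/-!
# Motivic door / EXTREMISERS-B — the LEHMANN–GOERISCH lower bound for `ε₁` in form language
# (kernel-checked soundness of the `(L)` rows of the `rhdoor.extrem2.cert/1` certificates)

pub-rhdoor (MOTIVIC-DOOR ticket), unit `extrem-2`. HONEST FRAMING (verbatim): lottery ticket at the motivic door;
RH probability negligible; consolation prizes are real: a new semi-local Weil-positivity theorem, or a located gap
in the Connes–Consani programme, plus the ff-door theorem.

WHAT THIS FILE IS. `EXTREMISERS-B.md` §B.8/§B.11 publish Arb-CERTIFIED lower bounds `ε₁(Q_N(a)) ≥ β − s` for the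
bottom eigenvalue of the finite Weil-form Galerkin matrices `Q_N(a)` from finitely many CLOSED-FORM test vectors
(transported prolates, optionally one Krylov step), by the Lehmann–Goerisch method with an a-priori spectral
parameter `β` ([Lehmann1963], [GoerischHaunhorst1985]; Temple's inequality is the one-vector case).  Such a
certificate consists of two machine-checked inequalities about the real symmetric matrix `M = Q_N(a)`:

* (count) `M − β` is positive semidefinite on a subspace of codimension `≤ q`: there are `p ≤ q` constraint
  vectors `y₁ … y_p` with `β |g|² ≤ gᵀMg` whenever `y_j · g = 0` for all `j` (certified from an `LDLᵀ`
  factorisation of `M − β'` with exactly `p` negative pivots and a rounding budget `β = β' − η`, or from a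
  rank-`p` PSD update, `psdOn_of_rankUpdate`; monotone in `β`, `psdOn_mono`);
* (L) on a `q`-FRAME of test vectors `x₁ … x_q`, with `v_c = Σ cᵢ xᵢ` and SHIFTED RESIDUALS
  `w_c = M v_c − β v_c`, the `q × q` LEHMANN GRAM MATRIX is negative definite:
  `s · v_cᵀ w_c + w_cᵀ w_c < 0` for every `c ≠ 0` (`s = −1/τ̃ > 0` in the notation of §B.8; in Gram form `Σᵢ Σₖ cᵢ cₖ P_{ik} < 0` with
  `P = s·A₁ + A₂`, `(A₁)_{ik} = xᵢᵀ(M − β)xₖ`, `(A₂)_{ik} = ((M − β)xᵢ)ᵀ((M − β)xₖ)` — `lehmannGramSum_eq`).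

THEN `ε₁(M) ≥ β − s` (`sub_le_bottomRayleigh_of_lehmannGoerisch`, Gram form
`sub_le_bottomRayleigh_of_lehmannGram`, form-language form `lehmannGoerisch_form_bound`).  This file PROVES that
implication for every real symmetric matrix of positive size, every `β`, every `s > 0`, every `p ≤ q`, every frame
and constraint family — RH-free, `ζ`-free finite-dimensional linear algebra over the tree's `bottomRayleigh`
(`ε₁` := the infimum of Rayleigh quotients), with NO spectral theorem: the proof uses only the EXISTENCE of one
bottom vector (`exists_isBottomVector_of_isSymm`) and a dimension count (`p` homogeneous linear equations in
`q + 1 > p` unknowns, `LinearMap.ker_ne_bot_of_finrank_lt`).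

PROOF. Suppose `ε₁ < β − s`; let `u` be a unit bottom vector, `ν := ε₁ − β < −s < 0`.  CLAIM
(`shiftedForm_neg_of_lehmann`): the shifted form `hᵀMh − β|h|²` is NEGATIVE at every `h = v_c + t u` with
`(c, t) ≠ 0`.  (If `c = 0` it equals `ν t² < 0`.  If `c ≠ 0`: `u · w_c = ν (u · v_c)` by symmetry, so
Cauchy–Schwarz gives `ν² (u·v_c)² ≤ |w_c|²`, while (L) gives `|w_c|² < −s · v_cᵀw_c`; expanding along the line,
`hᵀMh − β|h|² = ν (t + u·v_c)² − ν (u·v_c)² + v_cᵀw_c ≤ |w_c|²/|ν| + v_cᵀw_c < (1 − s/|ν|) · v_cᵀw_c ≤ 0`.)  But the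
`p ≤ q` linear constraints of (count) have a nonzero common solution `(c, t)` in the `(q+1)`-parameter family,
and there (count) says the shifted form is `≥ 0` — contradiction.  (Injectivity of `(c, t) ↦ h` is not needed.)

RELATION TO THE TREE. The deflated Temple / Lehmann–Maehly bound `Literature.Analysis.OperatorTheory.
deflatedFormBound_of_decomp` (and prover B's `dt_deflatedFormBound₂`) is the INTERMEDIATE-PROBLEM variant: the
complement bound `β` is assumed on the orthocomplement OF THE TRIAL VECTORS.  The present file is the a-priori-COUNT
(Goerisch) variant: the constraints `y_j` are arbitrary and decoupled from the frame, which is exactly what a purely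
finite-dimensional certificate can discharge (inertia of `M − β`).

LABELS. Every declaration below is PROVED (kernel-checked, no `sorry`, no new axioms; no definitions) and speaks
about finite matrices only.  Which matrices, `β`, frames and numbers `s` it is APPLIED to is DATA/CERT of EXTREMISERS-B: the Arb
job certifies (count) and (L) for `M = Q_N(a)`; nothing about the Weil form in infinite dimension, let alone RH, is
claimed here.  [folklore] = standard numerical linear algebra (Lehmann 1963; Goerisch–Haunhorst 1985; Behnke–Goerisch).
-/

noncomputable section

open Finset Matrix
open scoped BigOperators

namespace Summit.RiemannHypothesis.RiemannHypothesis.Theorems.MotivicDoor.LehmannGoerisch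

open Summit.RiemannHypothesis.RiemannHypothesis.Theorems.PfPersistence

/-! ## §1 Helpers: Cauchy–Schwarz, symmetry, bilinear bookkeeping -/

/-- PROVED: Cauchy–Schwarz for the dot product on `Fin m → ℝ`. [folklore] -/
theorem dotProduct_sq_le {m : ℕ} (x w : Fin m → ℝ) : (x ⬝ᵥ w) ^ 2 ≤ (x ⬝ᵥ x) * (w ⬝ᵥ w) := by
  have h := Finset.sum_mul_sq_le_sq_mul_sq (Finset.univ : Finset (Fin m)) x w
  simpa only [dotProduct, pow_two] using h

/-- PROVED: bilinear expansion `(Σ cᵢ aᵢ) · (Σ c_k b_k) = Σᵢ Σ_k cᵢ c_k (aᵢ · b_k)`. [folklore] -/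
theorem sum_smul_dotProduct_sum_smul {m q : ℕ} (c : Fin q → ℝ) (a b : Fin q → Fin m → ℝ) :
    (∑ i, c i • a i) ⬝ᵥ (∑ k, c k • b k) = ∑ i, ∑ k, c i * c k * (a i ⬝ᵥ b k) := by
  rw [sum_dotProduct]
  refine Finset.sum_congr rfl fun i _ => ?_
  rw [dotProduct_sum]
  refine Finset.sum_congr rfl fun k _ => ?_
  rw [smul_dotProduct, dotProduct_smul, smul_eq_mul, smul_eq_mul]
  ring

/-- PROVED: the quadratic form of a matrix as a double sum, `cᵀ P c = Σᵢ Σ_k cᵢ c_k P_{ik}`. [folklore] -/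
theorem dotProduct_mulVec_eq_sum_sum {q : ℕ} (P : Matrix (Fin q) (Fin q) ℝ) (c : Fin q → ℝ) :
    c ⬝ᵥ (P *ᵥ c) = ∑ i, ∑ k, c i * c k * P i k := by
  simp only [dotProduct, mulVec, Finset.mul_sum]
  refine Finset.sum_congr rfl fun i _ => Finset.sum_congr rfl fun k _ => ?_
  ring

/-! ## §2 Bilinear bookkeeping for the frame: shifted residuals and the Lehmann Gram sum -/

/-- PROVED: the SHIFTED RESIDUAL `w = Mv − βv` is linear in the test vector: for `v_c = Σ cᵢ xᵢ`,
`w_c = Σ cᵢ (M xᵢ − β xᵢ)`. [folklore] -/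
theorem shiftRes_sum_smul {m q : ℕ} (M : Matrix (Fin m) (Fin m) ℝ) (β : ℝ) (x : Fin q → Fin m → ℝ)
    (c : Fin q → ℝ) :
    M *ᵥ (∑ i, c i • x i) - β • (∑ i, c i • x i) = ∑ i, c i • (M *ᵥ x i - β • x i) := by
  have hM : M *ᵥ (∑ i, c i • x i) = ∑ i, c i • (M *ᵥ x i) := by
    have h := map_sum M.mulVecLin (fun i => c i • x i) Finset.univ
    simpa only [Matrix.mulVecLin_apply, map_smul] using h
  simp only [hM, Finset.smul_sum, ← Finset.sum_sub_distrib, smul_sub]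
  refine Finset.sum_congr rfl fun i _ => ?_
  rw [smul_comm β (c i) (x i)]

/-- PROVED — THE LEHMANN GRAM SUM.  With the `q × q` LEHMANN GRAM MATRIX of the frame,
`P_{ik} = s · xᵢᵀ(M xₖ − β xₖ) + (M xᵢ − β xᵢ)ᵀ(M xₖ − β xₖ)` (`s·A₁ + A₂` in Lehmann's notation — the matrix whose
negative definiteness the Arb job certifies by a Cholesky factorisation of `−P` in ball arithmetic), the quadratic form
`cᵀPc = Σᵢ Σₖ cᵢ cₖ P_{ik}` (`dotProduct_mulVec_eq_sum_sum`) equals `s · v_cᵀ w_c + w_cᵀ w_c`. [folklore] -/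
theorem lehmannGramSum_eq {m q : ℕ} (M : Matrix (Fin m) (Fin m) ℝ) (β s : ℝ) (x : Fin q → Fin m → ℝ)
    (c : Fin q → ℝ) :
    ∑ i, ∑ k, c i * c k * (s * (x i ⬝ᵥ (M *ᵥ x k - β • x k)) + (M *ᵥ x i - β • x i) ⬝ᵥ (M *ᵥ x k - β • x k))
      = s * ((∑ i, c i • x i) ⬝ᵥ (M *ᵥ (∑ i, c i • x i) - β • ∑ i, c i • x i))
        + (M *ᵥ (∑ i, c i • x i) - β • ∑ i, c i • x i) ⬝ᵥ (M *ᵥ (∑ i, c i • x i) - β • ∑ i, c i • x i) := by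
  rw [shiftRes_sum_smul, sum_smul_dotProduct_sum_smul, sum_smul_dotProduct_sum_smul, Finset.mul_sum,
    ← Finset.sum_add_distrib]
  refine Finset.sum_congr rfl fun i _ => ?_
  rw [Finset.mul_sum, ← Finset.sum_add_distrib]
  refine Finset.sum_congr rfl fun k _ => ?_
  ring

/-! ## §3 The heart of the argument: negativity of the shifted form on the cone over the frame -/

/-- PROVED (the key inequality).  Let `u` be a UNIT BOTTOM VECTOR of the symmetric `M` and suppose
`ε₁ − β < −s < 0`.  If a test vector `v` with shifted residual `w = Mv − βv` satisfies the Lehmann inequality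
`s · vᵀw + wᵀw < 0`, then the shifted form is NEGATIVE on the whole line through `v` in direction `u`:
`hᵀMh − β hᵀh < 0` for `h = v + t u`, every real `t`.  (Symmetry gives `u·w = (ε₁ − β)(u·v)`; then
Cauchy–Schwarz and the expansion along the line.) [folklore] -/
theorem shiftedForm_neg_of_lehmann {n : ℕ} {M : Matrix (Fin (n + 1)) (Fin (n + 1)) ℝ} (hM : M.IsSymm)
    {u : Fin (n + 1) → ℝ} (hu : IsBottomVector M u) (hu1 : u ⬝ᵥ u = 1) {β s : ℝ} (hs : 0 < s)
    (hν : bottomRayleigh M - β < -s) {v : Fin (n + 1) → ℝ}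
    (hL : s * (v ⬝ᵥ (M *ᵥ v - β • v)) + (M *ᵥ v - β • v) ⬝ᵥ (M *ᵥ v - β • v) < 0) (t : ℝ) :
    (v + t • u) ⬝ᵥ (M *ᵥ (v + t • u)) - β * ((v + t • u) ⬝ᵥ (v + t • u)) < 0 := by
  have hν0 : bottomRayleigh M - β < 0 := by linarith
  have huMu : u ⬝ᵥ (M *ᵥ u) = bottomRayleigh M := by rw [form_eq_of_isBottomVector hu, hu1, mul_one]
  have huMv : u ⬝ᵥ (M *ᵥ v) = bottomRayleigh M * (u ⬝ᵥ v) := by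
    -- symmetry `uᵀMv = vᵀMu` (as in `Literature…KaloshinZhang2018.BlockForm.dotProduct_mulVec_symm`), then `Mu = ε₁u`
    rw [dotProduct_mulVec, ← mulVec_transpose, hM.eq, dotProduct_comm (M *ᵥ u) v,
      dotProduct_mulVec_of_isBottomVector hu, dotProduct_comm v u]
  have huw : u ⬝ᵥ (M *ᵥ v - β • v) = (bottomRayleigh M - β) * (u ⬝ᵥ v) := by
    rw [dotProduct_sub, dotProduct_smul, smul_eq_mul, huMv]; ring
  -- Cauchy–Schwarz against the unit vector `u`: ν² (u·v)² ≤ |w|²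
  have hCS : ((bottomRayleigh M - β) * (u ⬝ᵥ v)) ^ 2 ≤ (M *ᵥ v - β • v) ⬝ᵥ (M *ᵥ v - β • v) := by
    have h := dotProduct_sq_le u (M *ᵥ v - β • v)
    rw [huw, hu1, one_mul] at h
    exact h
  have hVe : v ⬝ᵥ (M *ᵥ v - β • v) = v ⬝ᵥ (M *ᵥ v) - β * (v ⬝ᵥ v) := by
    rw [dotProduct_sub, dotProduct_smul, smul_eq_mul]
  -- expansion of the shifted form along the line
  have hexp : (v + t • u) ⬝ᵥ (M *ᵥ (v + t • u)) - β * ((v + t • u) ⬝ᵥ (v + t • u))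
      = (bottomRayleigh M - β) * (t + u ⬝ᵥ v) ^ 2 - (bottomRayleigh M - β) * (u ⬝ᵥ v) ^ 2
        + (v ⬝ᵥ (M *ᵥ v) - β * (v ⬝ᵥ v)) := by
    rw [form_add_smul_of_isSymm hM v u t, dotProduct_add_smul_self v u t, huMu, huMv, hu1]
    ring
  rw [hexp, ← hVe]
  have hsq : (bottomRayleigh M - β) * (t + u ⬝ᵥ v) ^ 2 ≤ 0 := by
    nlinarith [sq_nonneg (t + u ⬝ᵥ v), hν0]
  have hV : v ⬝ᵥ (M *ᵥ v - β • v) < 0 := by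
    nlinarith [hCS, hL, sq_nonneg ((bottomRayleigh M - β) * (u ⬝ᵥ v)), hs]
  have hνpos : 0 < -(bottomRayleigh M - β) := by linarith
  -- −ν · (−ν (u·v)² + vᵀw) = ν²(u·v)² − ν vᵀw ≤ |w|² − ν vᵀw < −s vᵀw − ν vᵀw = (−s − ν)·vᵀw < 0
  have hprod : -(bottomRayleigh M - β) *
      (-(bottomRayleigh M - β) * (u ⬝ᵥ v) ^ 2 + v ⬝ᵥ (M *ᵥ v - β • v)) < 0 := by
    have h1 : 0 < (-s - (bottomRayleigh M - β)) * (-(v ⬝ᵥ (M *ᵥ v - β • v))) :=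
      mul_pos (by linarith) (by linarith)
    nlinarith [hCS, hL, h1]
  have hkey : -(bottomRayleigh M - β) * (u ⬝ᵥ v) ^ 2 + v ⬝ᵥ (M *ᵥ v - β • v) < 0 := by
    by_contra hc
    exact absurd hprod (not_lt.2 (mul_nonneg hνpos.le (not_lt.1 hc)))
  linarith

/-! ## §4 The Lehmann–Goerisch theorem (a-priori count version) -/

/-- **PROVED — LEHMANN–GOERISCH LOWER BOUND FOR `ε₁`, a-priori-count version.**  `M` real symmetric of size
`n + 1`; `s > 0`; `p ≤ q`; (count) `β|g|² ≤ gᵀMg` for every `g` orthogonal to the `p` constraint vectors `y_j`;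
(L) for every nonzero coefficient vector `c` the test vector `v_c = Σ cᵢ xᵢ` of the `q`-frame `x` and its shifted
residual `w_c = Mv_c − βv_c` satisfy `s · v_cᵀw_c + w_cᵀw_c < 0`.  THEN `β − s ≤ ε₁(M) = bottomRayleigh M`.
(In Lehmann's parametrisation `s = −1/μ_q` with `μ_q < 0` the `q`-th smallest eigenvalue of the pencil
`A₁ z = μ A₂ z`; the bound is `β + 1/μ_q`.) [folklore] -/
theorem sub_le_bottomRayleigh_of_lehmannGoerisch {n p q : ℕ} {M : Matrix (Fin (n + 1)) (Fin (n + 1)) ℝ}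
    (hM : M.IsSymm) {β s : ℝ} (hs : 0 < s) (hpq : p ≤ q)
    (y : Fin p → Fin (n + 1) → ℝ)
    (hcount : ∀ g : Fin (n + 1) → ℝ, (∀ j, y j ⬝ᵥ g = 0) → β * (g ⬝ᵥ g) ≤ g ⬝ᵥ (M *ᵥ g))
    (x : Fin q → Fin (n + 1) → ℝ)
    (hL : ∀ c : Fin q → ℝ, c ≠ 0 →
      s * ((∑ i, c i • x i) ⬝ᵥ (M *ᵥ (∑ i, c i • x i) - β • ∑ i, c i • x i))
        + (M *ᵥ (∑ i, c i • x i) - β • ∑ i, c i • x i) ⬝ᵥ (M *ᵥ (∑ i, c i • x i) - β • ∑ i, c i • x i)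
          < 0) :
    β - s ≤ bottomRayleigh M := by
  obtain ⟨u, hu, hu1⟩ := exists_isBottomVector_of_isSymm hM
  by_contra hlt
  have hν : bottomRayleigh M - β < -s := by linarith [lt_of_not_ge hlt]
  -- CLAIM: the shifted form is negative on every nonzero parameter (c, t) of the family h = v_c + t u
  have hN : ∀ (c : Fin q → ℝ) (t : ℝ), (c ≠ 0 ∨ t ≠ 0) →
      ((∑ i, c i • x i) + t • u) ⬝ᵥ (M *ᵥ ((∑ i, c i • x i) + t • u))
        - β * (((∑ i, c i • x i) + t • u) ⬝ᵥ ((∑ i, c i • x i) + t • u)) < 0 := by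
    intro c t hct
    by_cases hc : c = 0
    · have ht : t ≠ 0 := hct.resolve_left (not_not.2 hc)
      subst hc
      simp only [Pi.zero_apply, zero_smul, Finset.sum_const_zero, zero_add, mulVec_smul, dotProduct_smul,
        smul_dotProduct, smul_eq_mul, form_eq_of_isBottomVector hu, hu1, mul_one]
      have ht2 : 0 < t * t := mul_self_pos.2 ht
      have hεβ : 0 < -(bottomRayleigh M - β) := by linarith
      nlinarith [mul_pos ht2 hεβ]
    · exact shiftedForm_neg_of_lehmann hM hu hu1 hs hν (hL c hc) t
  -- DIMENSION COUNT: the p constraints are linear in the q + 1 parameters (c, t)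
  let B : Matrix (Fin p) (Fin (q + 1)) ℝ :=
    Matrix.of fun j k => Fin.snoc (α := fun _ => ℝ) (fun i : Fin q => y j ⬝ᵥ x i) (y j ⬝ᵥ u) k
  have hker : LinearMap.ker (Matrix.mulVecLin B) ≠ ⊥ := by
    apply LinearMap.ker_ne_bot_of_finrank_lt
    simp only [Module.finrank_fin_fun]
    omega
  obtain ⟨d, hdker, hd0⟩ := Submodule.exists_mem_ne_zero_of_ne_bot hker
  have hBd : B *ᵥ d = 0 := by simpa only [LinearMap.mem_ker, Matrix.mulVecLin_apply] using hdker
  have hct : (fun i : Fin q => d (Fin.castSucc i)) ≠ 0 ∨ d (Fin.last q) ≠ 0 := by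
    by_contra hnot
    push Not at hnot
    obtain ⟨h1, h2⟩ := hnot
    apply hd0
    funext k
    induction k using Fin.lastCases with
    | last => simpa using h2
    | cast i => simpa using congr_fun h1 i
  have horth : ∀ j, y j ⬝ᵥ ((∑ i, (fun i : Fin q => d (Fin.castSucc i)) i • x i) + d (Fin.last q) • u) = 0 := by
    intro j
    have hj : (B *ᵥ d) j = 0 := by rw [hBd]; rfl
    have hrow : (B *ᵥ d) j = (∑ i : Fin q, (y j ⬝ᵥ x i) * d (Fin.castSucc i)) + (y j ⬝ᵥ u) * d (Fin.last q) := by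
      change ∑ k : Fin (q + 1), B j k * d k = _
      rw [Fin.sum_univ_castSucc]
      simp only [B, Matrix.of_apply, Fin.snoc_castSucc, Fin.snoc_last]
    rw [hrow] at hj
    have hj' : (∑ i : Fin q, d (Fin.castSucc i) * (y j ⬝ᵥ x i)) + d (Fin.last q) * (y j ⬝ᵥ u) = 0 := by
      rw [← hj]
      congr 1
      · exact Finset.sum_congr rfl fun i _ => mul_comm _ _
      · exact mul_comm _ _
    rw [dotProduct_add, dotProduct_sum, dotProduct_smul, smul_eq_mul]
    simp only [dotProduct_smul, smul_eq_mul]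
    linarith [hj']
  have hpos := hcount _ (horth)
  have hneg := hN (fun i : Fin q => d (Fin.castSucc i)) (d (Fin.last q)) hct
  linarith

/-- **PROVED — the same bound with hypothesis (L) in GRAM FORM**: `Σᵢ Σₖ cᵢ cₖ P_{ik} < 0` for `c ≠ 0`, `P` the
Lehmann Gram matrix `s·A₁ + A₂` of the frame (literally the inequality the Arb certificate checks; `= cᵀPc` by
`dotProduct_mulVec_eq_sum_sum`). [folklore] -/
theorem sub_le_bottomRayleigh_of_lehmannGram {n p q : ℕ} {M : Matrix (Fin (n + 1)) (Fin (n + 1)) ℝ}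
    (hM : M.IsSymm) {β s : ℝ} (hs : 0 < s) (hpq : p ≤ q)
    (y : Fin p → Fin (n + 1) → ℝ)
    (hcount : ∀ g : Fin (n + 1) → ℝ, (∀ j, y j ⬝ᵥ g = 0) → β * (g ⬝ᵥ g) ≤ g ⬝ᵥ (M *ᵥ g))
    (x : Fin q → Fin (n + 1) → ℝ)
    (hL : ∀ c : Fin q → ℝ, c ≠ 0 →
      ∑ i, ∑ k, c i * c k *
        (s * (x i ⬝ᵥ (M *ᵥ x k - β • x k)) + (M *ᵥ x i - β • x i) ⬝ᵥ (M *ᵥ x k - β • x k)) < 0) :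
    β - s ≤ bottomRayleigh M := by
  refine sub_le_bottomRayleigh_of_lehmannGoerisch hM hs hpq y hcount x fun c hc => ?_
  have h := hL c hc
  rwa [lehmannGramSum_eq] at h

/-- PROVED — FORM-LANGUAGE COROLLARY: under (count) and (L) (Gram form), `(β − s)|g|² ≤ gᵀMg` for EVERY vector
`g`. [folklore] -/
theorem lehmannGoerisch_form_bound {n p q : ℕ} {M : Matrix (Fin (n + 1)) (Fin (n + 1)) ℝ}
    (hM : M.IsSymm) {β s : ℝ} (hs : 0 < s) (hpq : p ≤ q)
    (y : Fin p → Fin (n + 1) → ℝ)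
    (hcount : ∀ g : Fin (n + 1) → ℝ, (∀ j, y j ⬝ᵥ g = 0) → β * (g ⬝ᵥ g) ≤ g ⬝ᵥ (M *ᵥ g))
    (x : Fin q → Fin (n + 1) → ℝ)
    (hL : ∀ c : Fin q → ℝ, c ≠ 0 →
      ∑ i, ∑ k, c i * c k *
        (s * (x i ⬝ᵥ (M *ᵥ x k - β • x k)) + (M *ᵥ x i - β • x i) ⬝ᵥ (M *ᵥ x k - β • x k)) < 0)
    (g : Fin (n + 1) → ℝ) :
    (β - s) * (g ⬝ᵥ g) ≤ g ⬝ᵥ (M *ᵥ g) :=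
  (mul_le_mul_of_nonneg_right (sub_le_bottomRayleigh_of_lehmannGram hM hs hpq y hcount x hL)
    (dotProduct_self_nonneg_real g)).trans (bottomRayleigh_mul_le_form M g)

/-! ## §5 Discharging (count) from finite data -/

/-- PROVED: a RANK-`p` PSD UPDATE certificate gives (count): if `β|g|² ≤ gᵀMg + Σ_j d_j (y_j·g)²` for all `g`
(e.g. `M − β + Σ d_j y_j y_jᵀ ⪰ 0`, certified by one Cholesky factorisation in ball arithmetic), then
`β|g|² ≤ gᵀMg` on the common kernel of the `y_j`. [folklore] -/
theorem psdOn_of_rankUpdate {m p : ℕ} {M : Matrix (Fin m) (Fin m) ℝ} {β : ℝ} (y : Fin p → Fin m → ℝ)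
    (d : Fin p → ℝ) (h : ∀ g : Fin m → ℝ, β * (g ⬝ᵥ g) ≤ g ⬝ᵥ (M *ᵥ g) + ∑ j, d j * (y j ⬝ᵥ g) ^ 2) :
    ∀ g : Fin m → ℝ, (∀ j, y j ⬝ᵥ g = 0) → β * (g ⬝ᵥ g) ≤ g ⬝ᵥ (M *ᵥ g) := by
  intro g hg
  have h' := h g
  simpa [hg] using h'

/-- PROVED: (count) is MONOTONE in `β`: a rounding budget `η ≥ 0` may be absorbed, `β' − η` works if `β'` does.
[folklore] -/
theorem psdOn_mono {m p : ℕ} {M : Matrix (Fin m) (Fin m) ℝ} {β β' : ℝ} (hββ' : β ≤ β') (y : Fin p → Fin m → ℝ)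
    (h : ∀ g : Fin m → ℝ, (∀ j, y j ⬝ᵥ g = 0) → β' * (g ⬝ᵥ g) ≤ g ⬝ᵥ (M *ᵥ g)) :
    ∀ g : Fin m → ℝ, (∀ j, y j ⬝ᵥ g = 0) → β * (g ⬝ᵥ g) ≤ g ⬝ᵥ (M *ᵥ g) := fun g hg =>
  (mul_le_mul_of_nonneg_right hββ' (dotProduct_self_nonneg_real g)).trans (h g hg)

/-- PROVED: with NO constraints (`p = 0`, i.e. `M ⪰ β`) hypothesis (count) already gives `β ≤ ε₁` — the trivial end
of the scale, recorded so that cert rows with `q = 0` below `β` need no frame. [folklore] -/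
theorem le_bottomRayleigh_of_psd {n : ℕ} {M : Matrix (Fin (n + 1)) (Fin (n + 1)) ℝ} {β : ℝ}
    (h : ∀ g : Fin (n + 1) → ℝ, β * (g ⬝ᵥ g) ≤ g ⬝ᵥ (M *ᵥ g)) : β ≤ bottomRayleigh M := by
  refine le_bottomRayleigh_of_forall M fun v hv => ?_
  have hvv : 0 < v ⬝ᵥ v :=
    lt_of_le_of_ne (dotProduct_self_nonneg_real v) fun h0 => hv (dotProduct_self_eq_zero.1 h0.symm)
  exact (le_div_iff₀ hvv).2 (h v)

end Summit.RiemannHypothesis.RiemannHypothesis.Theorems.MotivicDoor.LehmannGoerisch
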